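import Literature.NumberTheory.Sieve.Polymath8aCoefficientSequences
import Literature.NumberTheory.Sieve.ParityWave0MPZClaim
import HarnessLib

/-!
# Polymath 8a, Definition 2.6 (Type I/II/III estimates), Lemma 2.7 and Theorem 2.8

D. H. J. Polymath, *New equidistribution estimates of Zhang type*, Algebra & Number Theory 8:9
(2014) 2067–2199 = arXiv:1402.0811, §2B "Bilinear and trilinear estimates" (pp. 2077–2079).
The sibling files vendor Claim 2.3 as the parametrised predicate `MPZi i ϖ δ`
(`ParityWave0MPZClaim.lean`) and Definition 2.5 (coefficient sequences: `IsCoeffBound`,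
`IsLocatedAtScale`, `HasSiegelWalfisz`, `IsSmoothAtScale`; `Polymath8aCoefficientSequences.lean`),
whose header records that "Definition 2.6 and Lemma 2.7 are not stated here".  This file states
them, in the same uniform style and over that vocabulary:

* `Polymath8a.IsModuliSet i ϖ δ ε x I S` — the moduli of (2-3)/(2-10)/(2-14): a finite set `S` of
  squarefree `q ≤ x^{1/2+2ϖ+ε}` with all prime factors in `I` and `i`-tuply `x^δ`-densely divisible
  (`q ∈ D_I^{(i)}(x^δ)`, Definitions 2.1–2.2) — literally the hypothesis on `S` inside `MPZi`;
  `Polymath8a.discrepancySum γ X S a = ∑_{q ∈ S} |Δ(γ; a (q))|` over the tree's `apDiscrepancy`;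
* `Polymath8a.BilinearEstimate i ϖ δ lo hi` — the common text of Definition 2.6 (i) and (ii) with the
  exponent range `x^{lo} ⪅ N ⪅ x^{hi}` of (2-9)/(2-11) as a parameter;
  `Polymath8a.TypeI i ϖ δ σ` (Definition 2.6 (i)), `Polymath8a.TypeII i ϖ δ` (ii),
  `Polymath8a.TypeIII i ϖ δ σ` (iii) — REAL definitions;
* PROVED: monotonicity in the order `i` (`IsModuliSet.anti_index`, `BilinearEstimate.anti_index`,
  `TypeI.anti_index`, `TypeII.anti_index`, `TypeIII.anti_index` — the estimate for `i` applies to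
  every set of `i'`-tuply densely divisible moduli, `i ≤ i'`, by Lemma 2.10 (0) =
  `DenselyDivisible.anti`, exactly as `MPZi.anti_index`); the degenerate ranges
  (`BilinearEstimate.of_lt`, `TypeI.of_lt_two_mul`: (2-9) is empty for `σ < 2ϖ` — Lemma 2.7 assumes
  `σ > 2ϖ`; `TypeII.of_neg`: for `ϖ < 0` some `c > 0` empties (2-11); `TypeIII.of_one_sixth_lt`: for
  `σ > 1/6` the range (2-13) `x^{2σ} ⪅ N_j ⪅ x^{1/2−σ}` is empty — the rider of Lemma 3.1), which
  also witness that the predicates are inhabited;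
* NAMED FACTS (theorems in print, not proved here; six, declared): Lemma 2.7
  `Polymath8a.mpzi_of_typeEstimates` and Theorem 2.8 (i)–(v) `Polymath8a.typeI_one_of_lt`,
  `typeI_two_of_lt`, `typeI_four_of_lt`, `typeII_one_of_lt`, `typeIII_one_of_lt` — their printed
  proofs are §3 (Heath-Brown identity, Lemma 3.1, the Siegel–Walfisz theorem) and §§4–8 (Linnik's
  dispersion method, completion of sums, Weil/Deligne bounds, `ℓ`-adic trace functions), cf. the
  status paragraph of `mpz_of_lt` in `ParityWave0.lean`;
* PROVED from the named facts by the choice of `σ` (linear "σ-window" arithmetic): the two ranges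
  used by the DHL[42,2] certificate route, `mpzi_one_of_lt` (`108ϖ + 30δ < 1 ⟹ MPZ^{(1)}[ϖ, δ]`,
  from (i), (iv), (v)) and `mpzi_two_of_lt` (`56ϖ + 16δ < 3/5 ⟹ MPZ^{(2)}[ϖ, δ]`, from (ii), (iv),
  (v)).  The sibling `Polymath8aTypeEstimatesConsequences.lean` derives, in the same way, Lemma 2.7's
  rider (`σ > 1/6`), **Theorem 2.4 (i)** (`600ϖ + 180δ < 7 ⟹ MPZ^{(4)}`) and hence the tree's
  **parity.S29** `mpz_of_lt`, and the Deligne-free **Theorem 2.4 (ii)** (`168ϖ + 48δ < 1 ⟹ MPZ^{(2)}`).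

## Rendering of Definition 2.6 (faithfulness notes; conventions of Definition 1.2, p. 2072)

"We say that `Type_I^{(i)}[ϖ, δ, σ]` holds if, for any `I` and `a (P_I)` as above, any quantities
`M, N ≫ 1` with `MN ≍ x` (2-8) and `x^{1/2−σ} ⪅ N ⪅ x^{1/2−2ϖ−c}` (2-9) for some fixed `c > 0`, any
`Q ⪅ x^{1/2+2ϖ}`, and any coefficient sequences `α, β` located at scales `M, N` respectively, with
`β` having the Siegel–Walfisz property, we have `∑_{q ≤ Q, q ∈ D_I^{(i)}(x^δ)} |Δ(α ⋆ β; a (q))| ≪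
x log^{−A} x` (2-10) for any fixed `A > 0`"; (ii) the same with (2-11)
`x^{1/2−2ϖ−c} ⪅ N ⪅ x^{1/2}` "for some sufficiently small fixed `c > 0`"; (iii) four factors
`α ⋆ ψ₁ ⋆ ψ₂ ⋆ ψ₃`, `ψ_j` smooth at scales `N_j`, with (2-12) `M N₁ N₂ N₃ ≍ x`,
`N₁N₂, N₁N₃, N₂N₃ ⪆ x^{1/2+σ}` and (2-13) `x^{2σ} ⪅ N₁, N₂, N₃ ⪅ x^{1/2−σ}`.
(a) `I`, `a`, the moduli and "`Q ⪅`" exactly as in `MPZi` (notes (a)–(c), (e) there): `I` a finite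
set of primes, `a : ℤ` divisible by no prime of `I`, the sum over any finite `S` of admissible moduli
below `x^{1/2+2ϖ+ε}`, all `x ≥ 2`.  (b) Every "fixed"/implied constant that Definition 1.2 leaves
implicit is a parameter quantified BEFORE `∃ ε, C₀`: the target exponent `A`, the bound (2.2)
`(K, B)` (one pair serves all sequences), the support constants `0 < c ≤ · ≤ C` of "located at
scale" (`1 ≪ c < C ≪ 1`; the positivity of `c` is part of the printed notion and is kept), the
Siegel–Walfisz data `(Csw, Bsw)`, the smoothness data `(Kd, Bd)`, and the constants `0 < m₁, m₂` of
`≍` in (2-8)/(2-12) ("if asymptotic notation appears on the left-hand side of a statement, the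
assertion holds for any specific interpretation of that notation", Definition 1.2).  (c) "`⪅`"/"`⪆`"
in a HYPOTHESIS on `N` (a loss `x^{o(1)}`) is rendered, as "`Q ⪅`" is in `MPZi`, by one `ε > 0` of
slack OUTWARD on every such range (`x^{lo−ε} ≤ N ≤ x^{hi+ε}`), chosen together with the constant
`C₀` after the fixed data; this uniform form is equivalent to the printed one by the diagonal
argument recorded in `MPZi` (note (b) there) — a failure for every `ε = 1/n`, `C₀ = n` yields
`x_n → ∞` (bounded ranges of `x` obey the bound trivially, all data being fixed) and `x`-dependent
`M, N, α, β, Q` within `x^{o(1)}` of the nominal ranges violating (2-10).  (d) "for some fixed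
`c > 0`" in (i) qualifies the hypothesis (2-9), so the Type I bound is asserted for EVERY fixed
`c > 0` (constants depending on `c`): `TypeI := ∀ c > 0, …`; "for some sufficiently small fixed
`c > 0`" in (ii) is existential: `TypeII := ∃ c > 0, …` with `c` depending on `i, ϖ, δ` only — the
reading under which the proof of Lemma 2.7 (p. 2091: "either from Type_I (if
`N_S ≤ x^{1/2−2ϖ−c}` for sufficiently small fixed `c > 0`) or from Type_II (if `N_S > x^{1/2−2ϖ−c}`,
for the same value of `c`)") and Theorem 5.1 (iv) go through verbatim.  (e) "`M, N ≫ 1`" is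
`1 ≤ M, 1 ≤ N` (other fixed lower constants are absorbed by rescaling the scale and the support
constants, which are arbitrary).  (f) `Δ` is the tree's `apDiscrepancy` on any window `[1, X]`
containing the support of the convolution (hypothesis `∀ n > X, (α ⋆ β)(n) = 0`; the value does not
depend on such `X`, `Polymath8a.apDiscrepancy_eq_of_support`); the Siegel–Walfisz hypothesis is taken
on the window `[1, ⌊C N⌋]`, which contains the support of `β` (`IsLocatedAtScale.eq_zero_of_lt`).
(g) `⋆` is Mathlib's product of `ArithmeticFunction ℝ` (as in Lemma 3.4 (i) of the sibling file);
in (iii) the `ψ_j` are only asked to be smooth at scale `N_j` (Definition 2.5 (iii)), which implies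
"coefficient sequence located at scale `N_j`" (`IsSmoothAtScale.isCoeffBound`,
`IsSmoothAtScale.isLocatedAt`).  (h) The standing ranges "`0 < ϖ < 1/4`, `0 < δ < 1/4 + ϖ`,
`0 < σ < 1/2`, `i ≥ 1`" of Definition 2.6 are not baked into the predicates (which make sense for
all parameters); they are carried as hypotheses by the named facts, each of which is therefore no
stronger than its printed source.

NOT here: any proof of Lemma 2.7 or Theorem 2.8 (named facts); Theorem 2.9 (the Bombieri–Vinogradov
theorem in bilinear form); Zhang's and Pintz's earlier ranges quoted before Theorem 2.8.

## References

* D. H. J. Polymath, *New equidistribution estimates of Zhang type*, Algebra & Number Theory 8:9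
  (2014), 2067–2199, arXiv:1402.0811: Definition 1.2 (p. 2072), Claim 2.3 and Theorem 2.4
  (p. 2076), Definition 2.6 (pp. 2077–2078), Lemma 2.7 and Theorem 2.8 (p. 2079), Lemma 2.10 (0)
  (p. 2080), Lemma 3.1 (p. 2084), proof of Lemma 2.7 (pp. 2087–2093), Theorem 5.1 (p. 2113).
  [cite: Polymath8a2014]
-/

open Finset

namespace Literature.NumberTheory.Sieve

namespace Polymath8a

/-! ### The moduli and the discrepancy sums of (2-3), (2-10), (2-14) -/

/-- **The moduli of Claim 2.3 / Definition 2.6** at level `x^{1/2+2ϖ+ε}`: a finite set `S` of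
squarefree `q ≤ x^{1/2+2ϖ+ε}` whose prime factors lie in `I` and which are `i`-tuply
`x^δ`-densely divisible — "`q ≤ Q`, `q ∈ D_I^{(i)}(x^δ)`" with `Q ⪅ x^{1/2+2ϖ}`, rendered as in
`MPZi` (whose hypothesis on `S` this is, verbatim). [cite: Polymath8a2014, Definitions 2.1–2.2 and Claim 2.3] -/
def IsModuliSet (i : ℕ) (ϖ δ ε x : ℝ) (I S : Finset ℕ) : Prop :=
  ∀ q ∈ S, (q : ℝ) ≤ x ^ (1 / 2 + 2 * ϖ + ε) ∧ Squarefree q ∧ q.primeFactors ⊆ I ∧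
    DenselyDivisible (x ^ δ) i q

/-- A set of `i'`-tuply densely divisible moduli is a set of `i`-tuply densely divisible moduli for
`i ≤ i'` (Lemma 2.10 (0), `DenselyDivisible.anti`). [cite: Polymath8a2014, Lemma 2.10 (0)] -/
theorem IsModuliSet.anti_index {i i' : ℕ} {ϖ δ ε x : ℝ} {I S : Finset ℕ}
    (h : IsModuliSet i' ϖ δ ε x I S) (hii : i ≤ i') : IsModuliSet i ϖ δ ε x I S := fun q hq =>
  let ⟨h1, h2, h3, h4⟩ := h q hq
  ⟨h1, h2, h3, h4.anti hii⟩

/-- **The discrepancy sum** `∑_{q ∈ S} |Δ(γ; a (q))|` of (2-3)/(2-10)/(2-14), over the tree's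
`apDiscrepancy` on the window `[1, X]`, at the class of the integer `a` modulo each `q ∈ S`.
[cite: Polymath8a2014, (2-10)] -/
noncomputable def discrepancySum (γ : ℕ → ℝ) (X : ℕ) (S : Finset ℕ) (a : ℤ) : ℝ :=
  ∑ q ∈ S, |apDiscrepancy γ X q (a : ZMod q)|

/-- The discrepancy sum is nonnegative. [cite: Polymath8a2014, (2-10)] -/
theorem discrepancySum_nonneg (γ : ℕ → ℝ) (X : ℕ) (S : Finset ℕ) (a : ℤ) :
    0 ≤ discrepancySum γ X S a :=
  Finset.sum_nonneg fun _ _ => abs_nonneg _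

/-! ### Definition 2.6 -/

/-- **The common text of Definition 2.6 (i) and (ii)** with the `N`-range `x^{lo} ⪅ N ⪅ x^{hi}` of
(2-9)/(2-11) as a parameter (see the module docstring, notes (a)–(h), for the rendering): for all
fixed data — target exponent `A`, coefficient bound `(K, B)` of (2.2), support constants
`0 < c, C`, Siegel–Walfisz data `(Csw, Bsw)`, constants `0 < m₁, m₂` of `MN ≍ x` (2-8) — there are
`ε > 0` and `C₀` such that for all `x ≥ 2`, all finite sets `I` of primes and integers `a` coprime
to `P_I`, all `M, N ≥ 1` with `m₁ x ≤ MN ≤ m₂ x` and `x^{lo−ε} ≤ N ≤ x^{hi+ε}`, all coefficient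
sequences `α, β` (bound `(K, B)`) located at scales `M, N` (constants `c, C`) with `β` having the
Siegel–Walfisz property (data `Csw, Bsw`, window `[1, ⌊CN⌋]`), all admissible moduli sets `S` below
`x^{1/2+2ϖ+ε}` (`IsModuliSet`) and every window `[1, X]` containing the support of `α ⋆ β`:
`∑_{q ∈ S} |Δ(α ⋆ β; a (q))| ≤ C₀ x (log x)^{−A}`. [cite: Polymath8a2014, Definition 2.6 (i), (ii)] -/
def BilinearEstimate (i : ℕ) (ϖ δ lo hi : ℝ) : Prop :=
  ∀ (A K : ℝ) (B : ℕ) (c C : ℝ), 0 < c → ∀ (Csw : ℝ → ℝ) (Bsw : ℕ) (m₁ m₂ : ℝ), 0 < m₁ →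
    ∃ ε : ℝ, 0 < ε ∧ ∃ C₀ : ℝ, ∀ x : ℝ, 2 ≤ x →
      ∀ I : Finset ℕ, (∀ p ∈ I, p.Prime) → ∀ a : ℤ, (∀ p ∈ I, ¬(p : ℤ) ∣ a) →
      ∀ M N : ℝ, 1 ≤ M → 1 ≤ N → m₁ * x ≤ M * N → M * N ≤ m₂ * x →
        x ^ (lo - ε) ≤ N → N ≤ x ^ (hi + ε) →
      ∀ α β : ArithmeticFunction ℝ,
        IsCoeffBound K B x α → IsLocatedAtScale c C M α →
        IsCoeffBound K B x β → IsLocatedAtScale c C N β →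
        HasSiegelWalfisz Csw Bsw x N ⌊C * N⌋₊ β →
      ∀ S : Finset ℕ, IsModuliSet i ϖ δ ε x I S →
      ∀ X : ℕ, (∀ n : ℕ, X < n → (α * β) n = 0) →
        discrepancySum (α * β) X S a ≤ C₀ * x / Real.log x ^ A

/-- **Definition 2.6 (i), `Type_I^{(i)}[ϖ, δ, σ]`**: the bilinear estimate (2-10) for all
`M, N ≫ 1`, `MN ≍ x`, with `x^{1/2−σ} ⪅ N ⪅ x^{1/2−2ϖ−c}` (2-9) "for some fixed `c > 0`" — i.e. for
EVERY fixed `c > 0`, with constants depending on `c` (module docstring, note (d)).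
[cite: Polymath8a2014, Definition 2.6 (i)] -/
def TypeI (i : ℕ) (ϖ δ σ : ℝ) : Prop :=
  ∀ c : ℝ, 0 < c → BilinearEstimate i ϖ δ (1 / 2 - σ) (1 / 2 - 2 * ϖ - c)

/-- **Definition 2.6 (ii), `Type_II^{(i)}[ϖ, δ]`**: the bilinear estimate (2-10) for all
`M, N ≫ 1`, `MN ≍ x`, with `x^{1/2−2ϖ−c} ⪅ N ⪅ x^{1/2}` (2-11) "for some sufficiently small fixed
`c > 0`" — i.e. for SOME fixed `c > 0` depending on `i, ϖ, δ` only (module docstring, note (d)).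
[cite: Polymath8a2014, Definition 2.6 (ii)] -/
def TypeII (i : ℕ) (ϖ δ : ℝ) : Prop :=
  ∃ c : ℝ, 0 < c ∧ BilinearEstimate i ϖ δ (1 / 2 - 2 * ϖ - c) (1 / 2)

/-- **Definition 2.6 (iii), `Type_III^{(i)}[ϖ, δ, σ]`**: for all fixed data (as in
`BilinearEstimate`, with smoothness data `(Kd, Bd)` of Definition 2.5 (iii) in place of the
Siegel–Walfisz data) there are `ε > 0` and `C₀` such that for all `x ≥ 2`, `I`, `a` coprime to
`P_I`, all `M, N₁, N₂, N₃ ≥ 1` with `M N₁ N₂ N₃ ≍ x`, `N₁N₂, N₁N₃, N₂N₃ ≥ x^{1/2+σ−ε}` (2-12) and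
`x^{2σ−ε} ≤ N_j ≤ x^{1/2−σ+ε}` (2-13), every coefficient sequence `α` located at scale `M` and all
`ψ₁, ψ₂, ψ₃` smooth at scales `N₁, N₂, N₃`, all admissible moduli sets `S` below `x^{1/2+2ϖ+ε}` and
every window containing the support: `∑_{q ∈ S} |Δ(α ⋆ ψ₁ ⋆ ψ₂ ⋆ ψ₃; a (q))| ≤ C₀ x (log x)^{−A}`
(2-14). [cite: Polymath8a2014, Definition 2.6 (iii)] -/
def TypeIII (i : ℕ) (ϖ δ σ : ℝ) : Prop :=
  ∀ (A K : ℝ) (B : ℕ) (c C : ℝ), 0 < c → ∀ (Kd : ℕ → ℝ) (Bd : ℕ → ℕ) (m₁ m₂ : ℝ), 0 < m₁ →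
    ∃ ε : ℝ, 0 < ε ∧ ∃ C₀ : ℝ, ∀ x : ℝ, 2 ≤ x →
      ∀ I : Finset ℕ, (∀ p ∈ I, p.Prime) → ∀ a : ℤ, (∀ p ∈ I, ¬(p : ℤ) ∣ a) →
      ∀ M N₁ N₂ N₃ : ℝ, 1 ≤ M → 1 ≤ N₁ → 1 ≤ N₂ → 1 ≤ N₃ →
        m₁ * x ≤ M * N₁ * N₂ * N₃ → M * N₁ * N₂ * N₃ ≤ m₂ * x →
        x ^ (1 / 2 + σ - ε) ≤ N₁ * N₂ → x ^ (1 / 2 + σ - ε) ≤ N₁ * N₃ →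
        x ^ (1 / 2 + σ - ε) ≤ N₂ * N₃ →
        x ^ (2 * σ - ε) ≤ N₁ → N₁ ≤ x ^ (1 / 2 - σ + ε) →
        x ^ (2 * σ - ε) ≤ N₂ → N₂ ≤ x ^ (1 / 2 - σ + ε) →
        x ^ (2 * σ - ε) ≤ N₃ → N₃ ≤ x ^ (1 / 2 - σ + ε) →
      ∀ α ψ₁ ψ₂ ψ₃ : ArithmeticFunction ℝ,
        IsCoeffBound K B x α → IsLocatedAtScale c C M α →
        IsSmoothAtScale c C Kd Bd x N₁ ψ₁ → IsSmoothAtScale c C Kd Bd x N₂ ψ₂ →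
        IsSmoothAtScale c C Kd Bd x N₃ ψ₃ →
      ∀ S : Finset ℕ, IsModuliSet i ϖ δ ε x I S →
      ∀ X : ℕ, (∀ n : ℕ, X < n → (α * ψ₁ * ψ₂ * ψ₃) n = 0) →
        discrepancySum (α * ψ₁ * ψ₂ * ψ₃) X S a ≤ C₀ * x / Real.log x ^ A

/-! ### Monotonicity in the order `i` (Lemma 2.10 (0)) and the degenerate ranges of (2-9), (2-11), (2-13) -/

/-- The bilinear estimate for `i` implies the one for `i' ≥ i`: sets of `i'`-tuply densely divisible
moduli are sets of `i`-tuply densely divisible moduli (Lemma 2.10 (0)), so the admissible `S` only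
shrink — as for `MPZi.anti_index`. [cite: Polymath8a2014, Lemma 2.10 (0) and the remark after Theorem 2.4] -/
theorem BilinearEstimate.anti_index {i i' : ℕ} {ϖ δ lo hi : ℝ} (h : BilinearEstimate i ϖ δ lo hi)
    (hii : i ≤ i') : BilinearEstimate i' ϖ δ lo hi := by
  intro A K B c C hc Csw Bsw m₁ m₂ hm₁
  obtain ⟨ε, hε, C₀, hC⟩ := h A K B c C hc Csw Bsw m₁ m₂ hm₁
  exact ⟨ε, hε, C₀, fun x hx I hI a ha M N hM hN h1 h2 h3 h4 α β hα hαM hβ hβN hsw S hS X hX =>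
    hC x hx I hI a ha M N hM hN h1 h2 h3 h4 α β hα hαM hβ hβN hsw S (hS.anti_index hii) X hX⟩

/-- `Type_I^{(i)} ⟹ Type_I^{(i')}` for `i ≤ i'` (Lemma 2.10 (0)). [cite: Polymath8a2014, Lemma 2.10 (0) and Definition 2.6 (i)] -/
theorem TypeI.anti_index {i i' : ℕ} {ϖ δ σ : ℝ} (h : TypeI i ϖ δ σ) (hii : i ≤ i') :
    TypeI i' ϖ δ σ := fun c hc => (h c hc).anti_index hii

/-- `Type_II^{(i)} ⟹ Type_II^{(i')}` for `i ≤ i'` (Lemma 2.10 (0)). [cite: Polymath8a2014, Lemma 2.10 (0) and Definition 2.6 (ii)] -/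
theorem TypeII.anti_index {i i' : ℕ} {ϖ δ : ℝ} (h : TypeII i ϖ δ) (hii : i ≤ i') :
    TypeII i' ϖ δ :=
  let ⟨c, hc, h'⟩ := h
  ⟨c, hc, h'.anti_index hii⟩

/-- `Type_III^{(i)} ⟹ Type_III^{(i')}` for `i ≤ i'` (Lemma 2.10 (0)). [cite: Polymath8a2014, Lemma 2.10 (0) and Definition 2.6 (iii)] -/
theorem TypeIII.anti_index {i i' : ℕ} {ϖ δ σ : ℝ} (h : TypeIII i ϖ δ σ) (hii : i ≤ i') :
    TypeIII i' ϖ δ σ := by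
  intro A K B c C hc Kd Bd m₁ m₂ hm₁
  obtain ⟨ε, hε, C₀, hC⟩ := h A K B c C hc Kd Bd m₁ m₂ hm₁
  refine ⟨ε, hε, C₀, fun x hx I hI a ha M N₁ N₂ N₃ hM hN₁ hN₂ hN₃ h1 h2 h3 h4 h5 h6 h7 h8 h9 h10 h11
    α ψ₁ ψ₂ ψ₃ hα hαM hψ₁ hψ₂ hψ₃ S hS X hX => ?_⟩
  exact hC x hx I hI a ha M N₁ N₂ N₃ hM hN₁ hN₂ hN₃ h1 h2 h3 h4 h5 h6 h7 h8 h9 h10 h11 α ψ₁ ψ₂ ψ₃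
    hα hαM hψ₁ hψ₂ hψ₃ S (hS.anti_index hii) X hX

/-- **Degenerate range**: if `hi < lo` the `N`-range `x^{lo−ε} ≤ N ≤ x^{hi+ε}` is empty for
`ε = (lo − hi)/3` and `x ≥ 2`, so the bilinear estimate holds vacuously (and the predicate is
inhabited). [cite: Polymath8a2014, Definition 2.6 (i), (ii)] -/
theorem BilinearEstimate.of_lt (i : ℕ) (ϖ δ : ℝ) {lo hi : ℝ} (h : hi < lo) :
    BilinearEstimate i ϖ δ lo hi := by
  intro _ _ _ _ _ _ _ _ _ _ _
  refine ⟨(lo - hi) / 3, by linarith, 0, ?_⟩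
  intro x hx _ _ _ _ _ _ _ _ _ _ hlo hhi _ _ _ _ _ _ _ _ _ _ _
  have key := (Real.rpow_le_rpow_left_iff (show (1 : ℝ) < x by linarith)).mp (hlo.trans hhi)
  linarith

/-- **`Type_I^{(i)}[ϖ, δ, σ]` is vacuous for `σ < 2ϖ`**: then (2-9) `x^{1/2−σ} ⪅ N ⪅ x^{1/2−2ϖ−c}`
is empty for every `c > 0` — consistent with the hypothesis `σ > 2ϖ` of Lemma 2.7, under which the
Type I estimate has content. [cite: Polymath8a2014, Definition 2.6 (i) and Lemma 2.7] -/
theorem TypeI.of_lt_two_mul (i : ℕ) {ϖ : ℝ} (δ : ℝ) {σ : ℝ} (h : σ < 2 * ϖ) : TypeI i ϖ δ σ :=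
  fun _ hc => BilinearEstimate.of_lt i ϖ δ (by linarith)

/-- **`Type_II^{(i)}[ϖ, δ]` is vacuous for `ϖ < 0`**: with `c = −ϖ > 0` the range (2-11)
`x^{1/2−2ϖ−c} ⪅ N ⪅ x^{1/2}` is empty (the definition has content only for `ϖ ≥ 0`, the standing
range of Definition 2.6 being `0 < ϖ < 1/4`). [cite: Polymath8a2014, Definition 2.6 (ii)] -/
theorem TypeII.of_neg (i : ℕ) {ϖ : ℝ} (δ : ℝ) (h : ϖ < 0) : TypeII i ϖ δ :=
  ⟨-ϖ, by linarith, BilinearEstimate.of_lt i ϖ δ (by linarith)⟩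

/-- **For `σ > 1/6` the Type III estimate is vacuous**: the range (2-13)
`x^{2σ} ⪅ N_j ⪅ x^{1/2−σ}` is empty ("if `σ > 1/6`, then `2σ > 1/2 − σ`, and so the inequalities …
of the Type III alternative are inconsistent", proof of Lemma 3.1), whence the rider of Lemma 2.7
("if `σ > 1/6`, then the hypothesis `Type_III^{(i)}[ϖ, δ, σ]` may be omitted").  With
`ε = (3σ − 1/2)/3` no `N₁` satisfies `x^{2σ−ε} ≤ N₁ ≤ x^{1/2−σ+ε}` for `x ≥ 2`.
[cite: Polymath8a2014, Lemma 3.1 (rider, p. 2084) and Lemma 2.7] -/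
theorem TypeIII.of_one_sixth_lt (i : ℕ) (ϖ δ : ℝ) {σ : ℝ} (hσ : 1 / 6 < σ) : TypeIII i ϖ δ σ := by
  intro _ _ _ _ _ _ _ _ _ _ _
  refine ⟨(3 * σ - 1 / 2) / 3, by linarith, 0, ?_⟩
  intro x hx _ _ _ _ _ _ _ _ _ _ _ _ _ _ _ _ _ h6 h7 _ _ _ _ _ _ _ _ _ _ _ _ _ _ _ _ _
  have key := (Real.rpow_le_rpow_left_iff (show (1 : ℝ) < x by linarith)).mp (h6.trans h7)
  linarith

/-! ### Lemma 2.7 and Theorem 2.8 (named facts) -/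

/-- **Polymath 8a, Lemma 2.7 (combinatorial lemma)**: "Let `i ≥ 1` be a fixed integer, and let
`0 < ϖ < 1/4`, `0 < δ < 1/4 + ϖ`, and `1/10 < σ < 1/2` be fixed quantities with `σ > 2ϖ`, such that
the estimates `Type_I^{(i)}[ϖ, δ, σ]`, `Type_II^{(i)}[ϖ, δ]`, and `Type_III^{(i)}[ϖ, δ, σ]` all hold.
Then `MPZ^{(i)}[ϖ, δ]` holds."  (The rider "if `σ > 1/6`, then the hypothesis `Type_III` may be
omitted" is the theorem `mpzi_of_typeI_of_typeII` below.)  A theorem in print, NOT proved here: the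
printed proof (§3, pp. 2084–2093) combines the Heath-Brown identity (tree: `heathBrown_identity`),
a finer-than-dyadic decomposition (`Polymath8aPartitionOfUnity.lean`), Lemma 3.1 (tree:
`Polymath8a.combinatorialLemma`), Lemma 3.4 and the Siegel–Walfisz theorem; `MPZ^{(i)}` is the
tree's `MPZi`. [cite: Polymath8a2014, Lemma 2.7 (p. 2079)] -/
def mpzi_of_typeEstimates : Prop :=
  ∀ (i : ℕ) (ϖ δ σ : ℝ), 1 ≤ i → 0 < ϖ → ϖ < 1 / 4 → 0 < δ → δ < 1 / 4 + ϖ →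
    1 / 10 < σ → σ < 1 / 2 → 2 * ϖ < σ →
    TypeI i ϖ δ σ → TypeII i ϖ δ → TypeIII i ϖ δ σ → MPZi i ϖ δ

/-- **Polymath 8a, Theorem 2.8 (i)**: "Let `ϖ, δ, σ > 0` be fixed quantities. (i) If
`54ϖ + 15δ + 5σ < 1`, then `Type_I^{(1)}[ϖ, δ, σ]` holds."  The standing ranges of Definition 2.6
(`ϖ < 1/4`, `δ < 1/4 + ϖ`, `σ < 1/2`, implied here) are carried as hypotheses.  A theorem in print,
NOT proved here (§5, Theorem 5.1 (i): dispersion method, completion of sums, Weil's bound for curves;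
no use of Deligne's theorems). [cite: Polymath8a2014, Theorem 2.8 (i) (p. 2079) and Theorem 5.1 (i)] -/
def typeI_one_of_lt : Prop :=
  ∀ ϖ δ σ : ℝ, 0 < ϖ → ϖ < 1 / 4 → 0 < δ → δ < 1 / 4 + ϖ → 0 < σ → σ < 1 / 2 →
    54 * ϖ + 15 * δ + 5 * σ < 1 → TypeI 1 ϖ δ σ

/-- **Polymath 8a, Theorem 2.8 (ii)**: "If `56ϖ + 16δ + 4σ < 1`, then `Type_I^{(2)}[ϖ, δ, σ]`
holds" (`ϖ, δ, σ > 0` fixed; standing ranges of Definition 2.6 carried).  A theorem in print, NOT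
proved here (Theorem 5.1 (ii); no use of Deligne's theorems). [cite: Polymath8a2014, Theorem 2.8 (ii) (p. 2079) and Theorem 5.1 (ii)] -/
def typeI_two_of_lt : Prop :=
  ∀ ϖ δ σ : ℝ, 0 < ϖ → ϖ < 1 / 4 → 0 < δ → δ < 1 / 4 + ϖ → 0 < σ → σ < 1 / 2 →
    56 * ϖ + 16 * δ + 4 * σ < 1 → TypeI 2 ϖ δ σ

/-- **Polymath 8a, Theorem 2.8 (iii)**: "If `(160/3)ϖ + 16δ + (34/9)σ < 1` and
`64ϖ + 18δ + 2σ < 1`, then `Type_I^{(4)}[ϖ, δ, σ]` holds" (`ϖ, δ, σ > 0` fixed; standing ranges of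
Definition 2.6 carried).  A theorem in print, NOT proved here (Theorem 5.1 (iii) and §8, the
`q`-van der Corput method for trace functions; "the proofs of the claims in (iii) and (v) require
Deligne's work on the Riemann hypothesis over finite fields"). [cite: Polymath8a2014, Theorem 2.8 (iii) (p. 2079) and Theorem 5.1 (iii)] -/
def typeI_four_of_lt : Prop :=
  ∀ ϖ δ σ : ℝ, 0 < ϖ → ϖ < 1 / 4 → 0 < δ → δ < 1 / 4 + ϖ → 0 < σ → σ < 1 / 2 →
    160 / 3 * ϖ + 16 * δ + 34 / 9 * σ < 1 → 64 * ϖ + 18 * δ + 2 * σ < 1 → TypeI 4 ϖ δ σ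

/-- **Polymath 8a, Theorem 2.8 (iv)**: "If `68ϖ + 14δ < 1`, then `Type_II^{(1)}[ϖ, δ]` holds"
(`ϖ, δ > 0` fixed; standing ranges of Definition 2.6 carried).  A theorem in print, NOT proved here
(Theorem 5.1 (iv): Linnik's dispersion method; no use of Deligne's theorems). [cite: Polymath8a2014, Theorem 2.8 (iv) (p. 2079) and Theorem 5.1 (iv)] -/
def typeII_one_of_lt : Prop :=
  ∀ ϖ δ : ℝ, 0 < ϖ → ϖ < 1 / 4 → 0 < δ → δ < 1 / 4 + ϖ → 68 * ϖ + 14 * δ < 1 → TypeII 1 ϖ δ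

/-- **Polymath 8a, Theorem 2.8 (v)**: "If `σ > 1/18 + (28/9)ϖ + (2/9)δ` and `ϖ < 1/12`, then
`Type_III^{(1)}[ϖ, δ, σ]` holds" (`ϖ, δ, σ > 0` fixed; the standing ranges `δ < 1/4 + ϖ`, `σ < 1/2`
of Definition 2.6 carried).  A theorem in print, NOT proved here (§§6–7: `ℓ`-adic trace functions
and Deligne's theorems). [cite: Polymath8a2014, Theorem 2.8 (v) (p. 2079) and Theorem 7.1] -/
def typeIII_one_of_lt : Prop :=
  ∀ ϖ δ σ : ℝ, 0 < ϖ → ϖ < 1 / 12 → 0 < δ → δ < 1 / 4 + ϖ → 0 < σ → σ < 1 / 2 →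
    1 / 18 + 28 / 9 * ϖ + 2 / 9 * δ < σ → TypeIII 1 ϖ δ σ

/-! ### Consequences, proved from the named facts by the choice of `σ` -/

/-- **`MPZ^{(1)}[ϖ, δ]` for `108ϖ + 30δ < 1`** (`ϖ, δ > 0`), from Lemma 2.7 and Theorem 2.8 (i),
(iv), (v) — the range in which the DHL[42,2] certificate route uses plain (`i = 1`) dense
divisibility.  Choice of `σ`: the window `1/10 < σ < (1 − 54ϖ − 15δ)/5` is non-empty exactly when
`108ϖ + 30δ < 1`; take its midpoint; (iv), (v) and the hypotheses of Lemma 2.7 follow linearly.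
A corollary proved here; not displayed in the source, whose Theorem 2.4 records the cases `i = 4`
and (Deligne-free) `i = 2`. [cite: Polymath8a2014, Lemma 2.7 and Theorem 2.8 (i), (iv), (v) (corollary)] -/
theorem mpzi_one_of_lt (h27 : mpzi_of_typeEstimates) (h28i : typeI_one_of_lt)
    (h28iv : typeII_one_of_lt) (h28v : typeIII_one_of_lt) {ϖ δ : ℝ} (hϖ : 0 < ϖ) (hδ : 0 < δ)
    (h : 108 * ϖ + 30 * δ < 1) : MPZi 1 ϖ δ := by
  set σ : ℝ := (1 / 10 + (1 - 54 * ϖ - 15 * δ) / 5) / 2 with hσ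
  have hϖ4 : ϖ < 1 / 4 := by linarith
  have hϖ12 : ϖ < 1 / 12 := by linarith
  have hδ4 : δ < 1 / 4 + ϖ := by linarith
  have hσ0 : 0 < σ := by rw [hσ]; linarith
  have hσl : 1 / 10 < σ := by rw [hσ]; linarith
  have hσr : σ < 1 / 2 := by rw [hσ]; linarith
  have hσϖ : 2 * ϖ < σ := by rw [hσ]; linarith
  have hI : 54 * ϖ + 15 * δ + 5 * σ < 1 := by rw [hσ]; linarith
  have hII : 68 * ϖ + 14 * δ < 1 := by linarith
  have hIII : 1 / 18 + 28 / 9 * ϖ + 2 / 9 * δ < σ := by rw [hσ]; linarith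
  exact h27 1 ϖ δ σ le_rfl hϖ hϖ4 hδ hδ4 hσl hσr hσϖ (h28i ϖ δ σ hϖ hϖ4 hδ hδ4 hσ0 hσr hI)
    (h28iv ϖ δ hϖ hϖ4 hδ hδ4 hII) (h28v ϖ δ σ hϖ hϖ12 hδ hδ4 hσ0 hσr hIII)

/-- **`MPZ^{(2)}[ϖ, δ]` for `56ϖ + 16δ < 3/5`** (`ϖ, δ > 0`), from Lemma 2.7 and Theorem 2.8 (ii),
(iv), (v) — the range in which the DHL[42,2] certificate route uses double (`i = 2`) dense
divisibility.  Choice of `σ`: the window `1/10 < σ < (1 − 56ϖ − 16δ)/4` is non-empty exactly when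
`56ϖ + 16δ < 3/5`; take its midpoint; `Type_II^{(2)}`, `Type_III^{(2)}` come from (iv), (v) at
`i = 1` by Lemma 2.10 (0), with `68ϖ + 14δ < 1`, `1/18 + 28ϖ/9 + 2δ/9 < 1/10 < σ` and `ϖ < 1/12`.
A corollary proved here; not displayed in the source (whose Deligne-free Theorem 2.4 (ii) is the
sub-range `168ϖ + 48δ < 1`; `mpzi_two_of_lt_deligneFree` in `Polymath8aTypeEstimatesConsequences.lean`). [cite: Polymath8a2014, Lemma 2.7 and Theorem 2.8 (ii), (iv), (v) (corollary)] -/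
theorem mpzi_two_of_lt (h27 : mpzi_of_typeEstimates) (h28ii : typeI_two_of_lt)
    (h28iv : typeII_one_of_lt) (h28v : typeIII_one_of_lt) {ϖ δ : ℝ} (hϖ : 0 < ϖ) (hδ : 0 < δ)
    (h : 56 * ϖ + 16 * δ < 3 / 5) : MPZi 2 ϖ δ := by
  set σ : ℝ := (1 / 10 + (1 - 56 * ϖ - 16 * δ) / 4) / 2 with hσ
  have hϖ4 : ϖ < 1 / 4 := by linarith
  have hϖ12 : ϖ < 1 / 12 := by linarith
  have hδ4 : δ < 1 / 4 + ϖ := by linarith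
  have hσ0 : 0 < σ := by rw [hσ]; linarith
  have hσl : 1 / 10 < σ := by rw [hσ]; linarith
  have hσr : σ < 1 / 2 := by rw [hσ]; linarith
  have hσϖ : 2 * ϖ < σ := by rw [hσ]; linarith
  have hI : 56 * ϖ + 16 * δ + 4 * σ < 1 := by rw [hσ]; linarith
  have hII : 68 * ϖ + 14 * δ < 1 := by linarith
  have hIII : 1 / 18 + 28 / 9 * ϖ + 2 / 9 * δ < σ := by
    have : 1 / 18 + 28 / 9 * ϖ + 2 / 9 * δ < 1 / 10 := by linarith
    linarith
  exact h27 2 ϖ δ σ (by norm_num) hϖ hϖ4 hδ hδ4 hσl hσr hσϖ (h28ii ϖ δ σ hϖ hϖ4 hδ hδ4 hσ0 hσr hI)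
    ((h28iv ϖ δ hϖ hϖ4 hδ hδ4 hII).anti_index (by norm_num))
    ((h28v ϖ δ σ hϖ hϖ12 hδ hδ4 hσ0 hσr hIII).anti_index (by norm_num))

end Polymath8a

end Literature.NumberTheory.Sieve
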